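import Summits.AtomisticToContinuum.HydrodynamicLimit.Theorems.InfluenceLocality.Negative.ContactLate
import HarnessLib

/-!
# Localisation of an incoming contact (registered stub `stub_contactWindow`, refutation line
# `ignition-cascade-refutation`, crux `InfluenceLocality`, stmt-AtomisticToContinuum-13916)

Companion of Negative/ContactPerturbation.lean and Negative/ContactLate.lean (same notation), serving the
field `post` of `PhaseScript.TrackValid`. A mover–target pair has CURRENT relative position `q` and relative
velocity `u`; the nominal data are the current relative position `S` and relative velocity `u₀`, which reach
the contact sphere of radius `ε` at the SIGNED delay `σ₀` (impact vector `S + σ₀ u₀`), incoming with margin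
`κ` (`⟪S + σ₀ u₀, u₀⟫ ≤ -κ ε ‖u₀‖`). If `|σ₀| ≤ M`, the deviation budget
`‖q - S‖ + (M + s) ‖u - u₀‖ ≤ D` holds with `s = 2D/(κ‖u₀‖)`, `ε ‖u - u₀‖ ≤ D ‖u₀‖` and `0 < D < κ² ε / 4`,
then an actual INCOMING contact NOW (`‖q‖ = ε`, `⟪q, u⟫ < 0`) forces `|σ₀| ≤ s` and
`‖q - (S + σ₀ u₀)‖ ≤ (1 + 2/κ) D`.

Proof: reparametrise at `-M`: `q' = q - M u`, `q₀' = S - M u₀`, `t₀' = σ₀ + M ≥ 0`; the contact is at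
parameter `M`, the nominal contact at parameter `t₀'`, and the deviation at parameter `p ∈ [0, t₀' + s]` is
`(q - S) + (p - M)(u - u₀)`, of norm `≤ D`. Then `contactPerturbation_noEarly` excludes `σ₀ > s`,
`contactLate_inner_pos` excludes `σ₀ < -s` (the contact would be outgoing), and `contactPerturbation_normal`
gives the impact-vector estimate. Design-independent; asserts no Theses decl.
-/

namespace Summit.AtomisticToContinuum.HydrodynamicLimit.Theorems.InfluenceLocality.Negative

open MeasureTheory Set
open scoped InnerProductSpace
open Literature.Analysis.FluidPDE Literature.MathematicalPhysics.KineticTheory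
open Literature.Analysis.FunctionSpaces

noncomputable section

/-- Reparametrised deviation: `((q - M u) - (S - M u₀)) + p (u - u₀) = (q - S) + (p - M) (u - u₀)`. -/
theorem contactWindow_dev_eq {E : Type*} [NormedAddCommGroup E] [InnerProductSpace ℝ E]
    (S u₀ q u : E) (M p : ℝ) :
    ((q - M • u) - (S - M • u₀)) + p • (u - u₀) = (q - S) + (p - M) • (u - u₀) := by
  simp only [sub_smul, smul_sub]; abel

/-- Localisation of an incoming contact (general real inner product space). With nominal current relative
position `S`, relative velocity `u₀ ≠ 0`, signed nominal delay `σ₀` (`‖S + σ₀ u₀‖ = ε`, incoming with margin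
`κ`), `|σ₀| ≤ M`, deviation budget `‖q - S‖ + (M + 2D/(κ‖u₀‖)) ‖u - u₀‖ ≤ D`, `ε ‖u - u₀‖ ≤ D ‖u₀‖`,
`0 < D < κ² ε / 4`: an incoming contact now (`‖q‖ = ε`, `⟪q, u⟫ < 0`) has `|σ₀| ≤ 2D/(κ‖u₀‖)` and
`‖q - (S + σ₀ u₀)‖ ≤ (1 + 2/κ) D`. -/
theorem contactWindow_of_incoming {E : Type*} [NormedAddCommGroup E] [InnerProductSpace ℝ E]
    {S u₀ q u : E} {ε κ D σ₀ M : ℝ} (hε : 0 < ε) (hκ : 0 < κ) (hκ1 : κ ≤ 1) (hu₀ : u₀ ≠ 0)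
    (hD : 0 < D) (hDsmall : D < κ ^ 2 * ε / 4) (hM : 0 ≤ M) (hσM : |σ₀| ≤ M)
    (hcontact : ‖S + σ₀ • u₀‖ = ε) (hin : ⟪S + σ₀ • u₀, u₀⟫_ℝ ≤ -(κ * ε * ‖u₀‖))
    (hdev : ‖q - S‖ + (M + 2 * D / (κ * ‖u₀‖)) * ‖u - u₀‖ ≤ D) (hu : ε * ‖u - u₀‖ ≤ D * ‖u₀‖)
    (hq : ‖q‖ = ε) (hinc : ⟪q, u⟫_ℝ < 0) :
    |σ₀| ≤ 2 * D / (κ * ‖u₀‖) ∧ ‖q - (S + σ₀ • u₀)‖ ≤ (1 + 2 / κ) * D := by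
  have hL0 : 0 < ‖u₀‖ := norm_pos_iff.mpr hu₀
  have hκL : 0 < κ * ‖u₀‖ := mul_pos hκ hL0
  have hs0 : 0 ≤ 2 * D / (κ * ‖u₀‖) := div_nonneg (by linarith) hκL.le
  have hσ1 := (abs_le.1 hσM).1
  have hσ2 := (abs_le.1 hσM).2
  -- reparametrisation at `-M`: contact at parameter `M`, nominal contact at parameter `σ₀ + M ≥ 0`
  have ht₀ : 0 ≤ σ₀ + M := by linarith
  have hqM : (q - M • u) + M • u = q := sub_add_cancel q (M • u)
  have hnom : (S - M • u₀) + (σ₀ + M) • u₀ = S + σ₀ • u₀ := by rw [add_smul]; abel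
  have hcontact' : ‖(S - M • u₀) + (σ₀ + M) • u₀‖ = ε := by rw [hnom]; exact hcontact
  have hin' : ⟪(S - M • u₀) + (σ₀ + M) • u₀, u₀⟫_ℝ ≤ -(κ * ε * ‖u₀‖) := by rw [hnom]; exact hin
  have hct : ‖(q - M • u) + M • u‖ = ε := by rw [hqM]; exact hq
  -- the deviation over the window `[0, (σ₀ + M) + s]`
  have hdev_le : ∀ p ∈ Set.Icc 0 (σ₀ + M + 2 * D / (κ * ‖u₀‖)),
      ‖((q - M • u) - (S - M • u₀)) + p • (u - u₀)‖ ≤ D := by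
    intro p hp
    have habs : |p - M| ≤ M + 2 * D / (κ * ‖u₀‖) :=
      abs_le.2 ⟨by linarith [hp.1], by linarith [hp.2]⟩
    rw [contactWindow_dev_eq]
    calc ‖(q - S) + (p - M) • (u - u₀)‖ ≤ ‖q - S‖ + ‖(p - M) • (u - u₀)‖ := norm_add_le _ _
      _ = ‖q - S‖ + |p - M| * ‖u - u₀‖ := by rw [norm_smul, Real.norm_eq_abs]
      _ ≤ ‖q - S‖ + (M + 2 * D / (κ * ‖u₀‖)) * ‖u - u₀‖ := by
          gcongr
      _ ≤ D := hdev
  -- (i) no contact strictly before the window: `σ₀ ≤ s`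
  have hcase1 : σ₀ + M - 2 * D / (κ * ‖u₀‖) ≤ M := by
    refine not_lt.1 fun h => ?_
    have hdevM := hdev_le M ⟨hM, by linarith⟩
    have hfar := contactPerturbation_noEarly hε hκ hκ1 hu₀ hcontact' hin' hD.le hDsmall hdevM h
    rw [hct] at hfar
    exact lt_irrefl _ hfar
  -- (ii) no incoming contact strictly after the window: `-s ≤ σ₀`
  have hcase2 : M ≤ σ₀ + M + 2 * D / (κ * ‖u₀‖) := by
    refine not_lt.1 fun h => ?_
    have hdevE := hdev_le (σ₀ + M + 2 * D / (κ * ‖u₀‖)) ⟨by linarith, le_rfl⟩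
    have hout := contactLate_inner_pos hε hκ hκ1 hu₀ hcontact' hin' hD hDsmall hdevE h hct
    rw [hqM] at hout
    exact lt_irrefl _ (hout.trans hinc)
  refine ⟨abs_le.2 ⟨by linarith, by linarith⟩, ?_⟩
  -- (iii) contact in the window: impact vector near the nominal one
  have hn := contactPerturbation_normal hε hκ hκ1 ht₀ hu₀ hcontact' hin' hD.le hDsmall hdev_le hu
    ⟨hcase1, hcase2⟩ hct
  rwa [hqM, hnom] at hn

/-- LOCALISATION OF A DESIGNED CONTACT (registered stub (T6) of the skeleton of `IgnitionTemplates`, field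
`post` of `PhaseScript.TrackValid`). In `V3 = ℝ³`: nominal relative position `S` (mover minus target, now)
and relative velocity `u₀` reach the contact sphere of radius `ε` at the signed delay `σ₀`, `|σ₀| ≤ M`,
incoming with margin `κ`; if the actual data satisfy the deviation budget
`‖q - S‖ + (M + 2D/(κ‖u₀‖)) ‖u - u₀‖ ≤ D`, `ε ‖u - u₀‖ ≤ D ‖u₀‖` (`0 < D < κ² ε / 4`), then an incoming
contact now (`‖q‖ = ε`, `⟪q, u⟫ < 0`) has `|σ₀| ≤ 2D/(κ‖u₀‖)` and impact vector within `(1 + 2/κ) D` of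
the nominal `S + σ₀ u₀` (`contactPerturbation_noEarly`, `contactLate_inner_pos`, `contactPerturbation_normal`
after reparametrising at `-M`). -/
theorem stub_contactWindow :
    ∀ (S u₀ q u : V3) (ε κ D σ₀ M : ℝ),
    0 < ε → 0 < κ → κ ≤ 1 → u₀ ≠ 0 → 0 < D → D < κ ^ 2 * ε / 4 → 0 ≤ M → |σ₀| ≤ M →
    ‖S + σ₀ • u₀‖ = ε → ⟪S + σ₀ • u₀, u₀⟫_ℝ ≤ -(κ * ε * ‖u₀‖) →
    ‖q - S‖ + (M + 2 * D / (κ * ‖u₀‖)) * ‖u - u₀‖ ≤ D → ε * ‖u - u₀‖ ≤ D * ‖u₀‖ →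
    ‖q‖ = ε → ⟪q, u⟫_ℝ < 0 →
      |σ₀| ≤ 2 * D / (κ * ‖u₀‖) ∧ ‖q - (S + σ₀ • u₀)‖ ≤ (1 + 2 / κ) * D :=
  fun _ _ _ _ _ _ _ _ _ hε hκ hκ1 hu₀ hD hDsmall hM hσM hcontact hin hdev hu hq hinc =>
    contactWindow_of_incoming hε hκ hκ1 hu₀ hD hDsmall hM hσM hcontact hin hdev hu hq hinc

end

end Summit.AtomisticToContinuum.HydrodynamicLimit.Theorems.InfluenceLocality.Negative
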